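import Summits.NavierStokesRegularity.NavierStokesRegularity.Theses.SlicedKelvin
import Summits.NavierStokesRegularity.NavierStokesRegularity.Theorems.SlicedKelvinDefs
import Summits.NavierStokesRegularity.NavierStokesRegularity.Theorems.PlanarFluxAPriori.Negative.FalseWithoutEnergyClass
import Summits.NavierStokesRegularity.NavierStokesRegularity.Theorems.PlanarFluxAPriori.Negative.FoldCreationBudgetFalseWithoutEnergyClass
import Summits.NavierStokesRegularity.NavierStokesRegularity.Theorems.PlanarFluxAPriori.Negative.SlabApexBoundFalseKinematic
import Summits.NavierStokesRegularity.NavierStokesRegularity.Theorems.PlanarFluxAPriori.Negative.SlabApexBoundFalseKinematicLocal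

/-!
# Disproof of `PlanarFluxAPriori` — findings (crux disprover, cycle 1, 2026-08-17)

Crux `SlicedKelvin.PlanarFluxAPriori` (item `stmt-NavierStokesRegularity-15600`, rank 2, route
`route-NavierStokesRegularity-SlicedKelvin`), line `registered` = `Cruxes/PlanarFluxAPriori/Lines/birth.lean` (rev 2,
stubs `stub_decayPersistence`, `stub_epsFoldLaw`, `stub_foldLawPackage`, `stub_foldCreationBudget`).
Seat `refuter-cdisprove-stmt-NavierStokesRegularity-15600-0`. Builds on the crux-attack c1 (`CruxAttack-c1.md`,
negative lemma p150315 `Negative.planarFluxAPriori_false_without_energyClass`).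

## VERDICT: no kill. The crux is irrefutable short of exhibiting a finite-time blow-up whose unsigned planar
vorticity flux diverges (§B). What this file delivers instead:

* §A LOAD-BEARING HYPOTHESES (theorems):
  - A1 `crux_false_without_energyClass` — energy class (LH + rapid decay) load-bearing for the CRUX (plane Couette
    flow; landed p150315, re-exported);
  - A2 `planarFluxAPriori_iff_dropPosT` — `0 < T` is IDLE (for `T ≤ 0` the time set is empty);
  - A3/A4 (sections) — `0 < ν` and `classical` cannot be attacked cheaply (backward NS / junk `curl = 0` favours
    the conclusion);
  - A5 `budget_false_without_energyClass` — energy class load-bearing for the line's hardest stub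
    `stub_foldCreationBudget`, through the ε-REGULARISATION TERM, not through the flux (nilpotent shear
    `u = (x₁+x₂)(e₁−e₂)`: `f = ω₂ ≡ 0`, `s_ε ≡ ε > 0` on `ℝ³`); LANDED as
    `Negative/FoldCreationBudgetFalseWithoutEnergyClass.lean` (p152654, accepted), re-exported here;
  - A6 (§D2) `Negative.epsFoldLaw_false_without_divFree` — INCOMPRESSIBILITY is load-bearing for the identity
    stub `stub_epsFoldLaw`: for the compactly supported gradient field `v = ∇(½x₂²ψ)` (`ψ` a smooth bump) every
    term vanishes (`curl v = 0`) except the ε-term `−∫_{ℝ²}ψ(y,0)dy < 0`; LANDED as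
    `Negative/EpsFoldLawFalseWithoutDivFree.lean` (p154029, accepted; cited by name in §D2 — importable as
    `…Theorems.PlanarFluxAPriori.Negative.EpsFoldLawFalseWithoutDivFree`), next to `epsFoldLawOn_neg_iff` (§D2b:
    `0 < ε` is only `ε ≠ 0`, the law is even in `ε`).
* §B WHY THE CRUX RESISTS (analysis sections): NoBlowup ⇒ crux on paper; ¬crux ⇔ a blow-up with `Φ* → ∞`; which
  scenarios would do it (Hou's axisymmetric log, any DSS blow-up with a tangential vorticity tail).
* §C NATURAL STRENGTHENINGS (analysis sections): uniform-in-solution `M` false on paper (amplitude × parabolic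
  scaling; formal proof needs a local-existence construction ⇒ candidate negative-lemma-modulo-H for a later
  cycle); POINTWISE-IN-TIME fold budget false at `t = 0` for admissible data (infinite initial fold complexity);
  monotone `Φ*` false numerically (card kit j004756).
* §D TARGETS — line `registered`, stub by stub: decayPersistence true on paper (T ≤ T* argument); epsFoldLaw
  re-derived by hand here, frame covariance incl. reflections, numerics kit j024721; foldLawPackage and the identity
  are SATISFIABLE at rest (`foldLawSubsolution_rest`, `epsFoldLawOn_rest`: the defs are not contradictory);
  foldCreationBudget: (i) A5, (ii) the ε-term forces `∇u(τ) ∈ L¹(ℝ³)` (cubic decay is NOT enough), (iii) the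
  `t → 0⁺` attack with infinite initial fold complexity and why it FAILS (super-polynomial faintness of fine folds
  vs polynomial coarse-vorticity generation), (iv) the residual open content = uniformity as `t ↑ T = T*`, plus an
  honest positive-time NODAL-AREA gap even for short times.
* §E NEAR-MISSES: none left with `sorry`.

Search note: `lit search` degraded this cycle (searchd connection reset, OpenAlex HTTP 429) — prior-art pointers in
§B/§D are from the route file and the c1 attack, not from a fresh search.

## Cycle g2-1 (seat `refuter-cdisprove-stmt-NavierStokesRegularity-15600-g2-0`, 2026-08-17): §F, line `Sketch`
Skeleton rev 4: stubs 1–4 LANDED, the only `sorry` is `stub_slabApexBound` (XL). NO KILL of the stub as registered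
(`t₀ > 0`: positive-time slices of NS solutions are not constructible here), but its two neighbours are FALSE, kernel-checked
and LANDED (`Negative/SlabApexBoundApexFoam{Profile,Field}.lean` p162505/p162506, `Negative/SlabApexBoundFalseKinematic.lean`
p163175): F1 the KINEMATIC form (stub conclusion for a general field under the hypotheses of the kinematic stubs
`stub_apexLipschitz`/`stub_slabSplit`, and even for admissible Clay data), F2 the `t₀ = 0` form (registered text with
`t₀ ∈ Ico 0 T`; via the PROVED `local_classical_lerayHopf_holds`). Witness = APEX FOAM (F3). §F4 says what therefore must
enter a proof (a nodal / frequency bound for `ω(t)·n`, uniform in `(t,R,c)` and the far field) and records a defect of the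
functional (one-sided TOUCHINGS are charged although the regular nodal set is empty).
-/

noncomputable section

-- Problem = summit for this single-conjunct summit: the duplicate namespace component is deliberate.
set_option linter.dupNamespace false

namespace Summit.NavierStokesRegularity.NavierStokesRegularity.Cruxes.PlanarFluxAPriori.Disproof

open MeasureTheory Set Function Filter Literature.Analysis.FluidPDE
open scoped ENNReal InnerProductSpace Topology

/-! ## §0 Readback probe -/

/-- READBACK (no sorry): the crux decl is, verbatim, the registered signature — `∀ ν T > 0, ∀ u p`, classical on
`Ico 0 T`, Leray–Hopf on `[0,T]` from `u 0`, Schwartz decay of `u 0` ⟹ `∃ M, ∀ t < T, ∀ R` (linear isometry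
equivalences, reflections included) `∀ c`, `∫⁻_{ℝ²} ‖⟪curl (u t) (R (y₀,y₁,c)), R e₂⟫‖ₑ ≤ ofReal M`. Honest `ℝ≥0∞`
flux, no junk operators (c1 readback confirmed). -/
example : Theses.SlicedKelvin.PlanarFluxAPriori ↔
    ∀ (ν T : ℝ), 0 < ν → 0 < T → ∀ (u : ℝ → EuclideanSpace ℝ (Fin 3) → EuclideanSpace ℝ (Fin 3))
      (p : ℝ → EuclideanSpace ℝ (Fin 3) → ℝ), IsClassicalNSSolutionOn (Set.Ico 0 T) ν 0 u p →
      IsLerayHopfOn T ν 0 (u 0) u → HasRapidSpatialDecay (u 0) → ∃ M : ℝ, ∀ t ∈ Set.Ico 0 T,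
      ∀ (R : EuclideanSpace ℝ (Fin 3) ≃ₗᵢ[ℝ] EuclideanSpace ℝ (Fin 3)) (c : ℝ),
      ∫⁻ y : EuclideanSpace ℝ (Fin 2), ‖inner ℝ (curl (u t) (R (WithLp.toLp 2 ![y 0, y 1, c])))
        (R (EuclideanSpace.single 2 1))‖ₑ ≤ ENNReal.ofReal M :=
  Iff.rfl

/-! ## §A Load-bearing hypotheses -/

/-- **A1 (energy class, landed p150315).** The crux with `IsLerayHopfOn` and `HasRapidSpatialDecay` dropped is
false (plane Couette flow `u = x₀e₁`: `curl u ≡ e₂`, flux through `{x₂ = 0}` is `⊤`). Re-export of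
`Theorems.PlanarFluxAPriori.Negative.planarFluxAPriori_false_without_energyClass`. Any proof of the crux must use
finite energy / decay in a way that fails for linear (non-decaying) flows. [folklore] -/
theorem crux_false_without_energyClass :
    ¬ (∀ (ν T : ℝ), 0 < ν → 0 < T →
        ∀ (u : ℝ → EuclideanSpace ℝ (Fin 3) → EuclideanSpace ℝ (Fin 3)) (p : ℝ → EuclideanSpace ℝ (Fin 3) → ℝ),
        IsClassicalNSSolutionOn (Set.Ico 0 T) ν 0 u p →
        ∃ M : ℝ, ∀ t ∈ Set.Ico 0 T, ∀ (R : EuclideanSpace ℝ (Fin 3) ≃ₗᵢ[ℝ] EuclideanSpace ℝ (Fin 3)) (c : ℝ),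
          ∫⁻ y : EuclideanSpace ℝ (Fin 2), ‖inner ℝ (curl (u t) (R (WithLp.toLp 2 ![y 0, y 1, c])))
            (R (EuclideanSpace.single 2 1))‖ₑ ≤ ENNReal.ofReal M) :=
  Theorems.PlanarFluxAPriori.Negative.planarFluxAPriori_false_without_energyClass

/-- The crux with the hypothesis `0 < T` dropped (everything else verbatim). -/
def PlanarFluxAPrioriDropPosT : Prop :=
  ∀ (ν T : ℝ), 0 < ν → ∀ (u : ℝ → EuclideanSpace ℝ (Fin 3) → EuclideanSpace ℝ (Fin 3))
    (p : ℝ → EuclideanSpace ℝ (Fin 3) → ℝ), IsClassicalNSSolutionOn (Set.Ico 0 T) ν 0 u p →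
    IsLerayHopfOn T ν 0 (u 0) u → HasRapidSpatialDecay (u 0) → ∃ M : ℝ, ∀ t ∈ Set.Ico 0 T,
    ∀ (R : EuclideanSpace ℝ (Fin 3) ≃ₗᵢ[ℝ] EuclideanSpace ℝ (Fin 3)) (c : ℝ),
    ∫⁻ y : EuclideanSpace ℝ (Fin 2), ‖inner ℝ (curl (u t) (R (WithLp.toLp 2 ![y 0, y 1, c])))
      (R (EuclideanSpace.single 2 1))‖ₑ ≤ ENNReal.ofReal M

/-- **A2 (`0 < T` is idle).** Dropping `0 < T` changes nothing: for `T ≤ 0` the time set `Ico 0 T` is empty and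
the conclusion holds with `M = 0`. Information for the prover: `hT` is decoration (it is only used through
`t ∈ Ico 0 T`). [folklore] -/
theorem planarFluxAPriori_iff_dropPosT :
    Theses.SlicedKelvin.PlanarFluxAPriori ↔ PlanarFluxAPrioriDropPosT := by
  constructor
  · intro h ν T hν u p hcl hLH hdec
    rcases lt_or_ge 0 T with hT | hT
    · exact h ν T hν hT u p hcl hLH hdec
    · exact ⟨0, fun t ht => absurd (ht.1.trans_lt ht.2) (not_lt.2 hT)⟩
  · intro h ν T hν _ u p hcl hLH hdec
    exact h ν T hν u p hcl hLH hdec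

/-! ### A3 (`0 < ν`): no cheap attack
With `0 < ν` dropped the statement quantifies over `ν = 0` (Euler: a cex is an Euler blow-up with divergent
planar flux — open) and `ν < 0` (backward NS: `u(t) = −v(T₀−t)` for a forward solution `v`; a cex needs
`u 0 = −v(T₀)` Schwartz, but forward NS flows decay only like `|x|⁻⁴` generically — Brandolese–Vigneron
instantaneous spreading — and no explicit rapidly decaying 3-D solution is known). Not constructible; recorded,
not pursued. -/

/-! ### A4 (`classical`): junk favours the conclusion
Dropping `IsClassicalNSSolutionOn` leaves a Leray–Hopf weak solution; where `u t` is not differentiable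
`curl (u t)` is the junk value `0`, so the flux DROPS. A witness would need `u t` differentiable with
non-integrable `curl (u t)·n` on a plane while `u` stays Leray–Hopf from Schwartz data: weak continuity pins
`u t` a.e., and the Fréchet derivative at a point of a plane is determined by the off-plane values, so null-set
modifications cannot raise the flux. No cheap cex; the hypothesis is nevertheless USED by the line (vorticity
equation, differentiation under the plane integral). -/

/-- **A5 (energy class is load-bearing for `stub_foldCreationBudget`, through the ε-term).** The registered
stub `stub_foldCreationBudget` of line `registered` with `IsLerayHopfOn T ν 0 (u 0) u` and
`HasRapidSpatialDecay (u 0)` dropped (inline, integrand verbatim) is FALSE. Witness: the nilpotent trace-free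
shear `u(t,x) = (x₁ + x₂)(e₁ − e₂)`, `p = 0` (entire classical NS solution for every `ν`,
`Negative.isClassicalNSSolutionOn_clm_of_sq_eq_zero`), frame `R = 1`, `t = ½`: `curl u ≡ −2e₀`, so
`f = ω₂ ≡ 0`, `∇f = 0` kills the fold term, while the ε-regularisation term is `−ε²·∂₂u₂/F_ε(0) = −ε²·(−1)/ε = ε`
EVERYWHERE; hence `∫⁻_{ℝ³} ofReal(s_ε) = ⊤` for every `ε > 0`, the Duhamel integral over `τ ∈ (0,½)` is `⊤`, the
`liminf_{ε→0⁺}` is `⊤ ≰ ↑B`. CONSEQUENCE: the ε-term is not innocuous — `(−ε²∂ₙuₙ/F_ε(f))⁺ ≤ ε(∂ₙuₙ)⁻` is `O(ε)`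
in `L¹(ℝ³)` only if `∇u(τ) ∈ L¹(ℝ³)` (uniformly integrable against `(t−τ)^{-1/2}dτ`); the CUBIC decay
`(1+‖x‖)³‖Du‖ ≤ C` carried by `stub_decayPersistence`/`stub_foldLawPackage` is borderline-insufficient
(`(1+|x|)⁻³ ∉ L¹(ℝ³)`), so the budget stub must use the true far-field decay `|∇u(τ,x)| ≲ |x|⁻⁵` of NS flows from
rapidly decaying data (Brandolese–Vigneron; Kukavica–Torres 2006) — or exploit that `f ≡ 0` on an open set makes
`s_ε = −ε ∂ₙuₙ` there. Re-export of the LANDED `Negative.foldCreationBudget_false_without_energyClass`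
(`Theorems/PlanarFluxAPriori/Negative/FoldCreationBudgetFalseWithoutEnergyClass.lean`, p152654, accepted). [folklore] -/
theorem budget_false_without_energyClass :
    ¬ (∀ (ν T : ℝ), 0 < ν → 0 < T →
        ∀ (u : ℝ → EuclideanSpace ℝ (Fin 3) → EuclideanSpace ℝ (Fin 3)) (p : ℝ → EuclideanSpace ℝ (Fin 3) → ℝ),
        IsClassicalNSSolutionOn (Set.Ico 0 T) ν 0 u p →
        ∃ B : NNReal, ∀ (R : EuclideanSpace ℝ (Fin 3) ≃ₗᵢ[ℝ] EuclideanSpace ℝ (Fin 3)), ∀ t ∈ Set.Ico 0 T,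
          Filter.liminf (fun ε : ℝ => ∫⁻ τ in Set.Ioo 0 t, ENNReal.ofReal (1 / Real.sqrt (ν * (t - τ))) *
            (∫⁻ x : EuclideanSpace ℝ (Fin 3), ENNReal.ofReal
              (-(inner ℝ (u τ x) (R (EuclideanSpace.single 2 1))) *
                (ε ^ 2 / Real.sqrt (inner ℝ (curl (u τ) x) (R (EuclideanSpace.single 2 1)) ^ 2 + ε ^ 2) ^ 3) *
                (inner ℝ (curl (u τ) x) (R (EuclideanSpace.single 0 1)) *
                    fderiv ℝ (fun z => inner ℝ (curl (u τ) z) (R (EuclideanSpace.single 2 1))) x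
                      (R (EuclideanSpace.single 0 1)) +
                  inner ℝ (curl (u τ) x) (R (EuclideanSpace.single 1 1)) *
                    fderiv ℝ (fun z => inner ℝ (curl (u τ) z) (R (EuclideanSpace.single 2 1))) x
                      (R (EuclideanSpace.single 1 1))) -
                ε ^ 2 * fderiv ℝ (fun z => inner ℝ (u τ z) (R (EuclideanSpace.single 2 1))) x
                  (R (EuclideanSpace.single 2 1)) /
                  Real.sqrt (inner ℝ (curl (u τ) x) (R (EuclideanSpace.single 2 1)) ^ 2 + ε ^ 2))))
            (nhdsWithin 0 (Set.Ioi 0)) ≤ (B : ENNReal)) :=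
  Theorems.PlanarFluxAPriori.Negative.foldCreationBudget_false_without_energyClass

/-! ## §B Why the crux resists (analysis; module-doc sections, no declarations) -/

/-! ### B1. NoBlowup ⇒ crux; hence ¬crux ⇔ a blow-up with divergent planar flux
On paper: a classical solution on `[0,T)` that is Leray–Hopf on `[0,T]` from Schwartz data coincides with the
Fujita–Kato mild solution (Serrin/Prodi weak–strong uniqueness) and `T ≤ T*` (a classical-on-`[0,T)` LH solution
cannot cross a strong blow-up time `T* < T`: far-field regularity of suitable solutions from decaying data, CKN
1982 Thm D, confines `‖u‖_∞`-growth to a bounded region where `u` is `C^∞` up to `T*`). If `T < T*` (or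
`T* = ∞`), the solution is smooth on `[0,T]` and the vorticity keeps every polynomial weight (Kukavica–Torres 2006
weighted vorticity bounds), so `Φ(t;R,c) ≤ ∫_{plane} |ω(t)| ≤ C ∫_{ℝ²}(1+|y|)⁻³ dy` uniformly in `t, R, c`: the crux
HOLDS for that `(u,T)`. So a counterexample is exactly a first blow-up time `T = T*` with
`limsup_{t↑T*} sup_{R,c} Φ = ∞` — an instance of the Millennium problem's negation with extra structure. No
finite/decidable shape; compute cannot certify it (card numerics j004756/j004759 show `Φ*` ×1.5–2 while `‖ω‖_∞`
×6.6 — consistent, not evidence either way). -/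

/-! ### B2. Which blow-up scenarios would refute it
(a) Hou's axisymmetric interior scenario (Hou2022PotentiallySingularNS): flux through a MERIDIONAL plane
= `‖ω_θ(t)‖_{L¹(dr dz)}` (both signs of `θ` counted), fitted `~ log(1/(T−t))` — divergent ⇒ would refute the crux
if the scenario is a true blow-up. (b) ANY discretely self-similar / Type-I blow-up whose profile has the generic
TANGENTIAL `|y|⁻²` vorticity tail (ChaeWolf2017Removing, Thm 1.1): planar flux through the centre
`~ C log(1/(T−t)) → ∞` ⇒ refutes; only purely radially threaded tails keep the flux bounded (then crux 3
`PlanarFluxLiouville` is the one at risk). (c) A vortex-sheet pair swept back and forth through one plane raises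
`Φ` cheaply (the route's own why-might-fail) — but bounded-energy smooth flows do this finitely often before
`T < T*`; only at `T*` can it accumulate. Upshot: the crux silently contains "no DSS blow-up with tangential tail",
a large open sub-problem (NRS 1996 / Tsai 1998 exclude only self-similar profiles in `L³`/finite local energy
classes). Graded: open-problem, not misstated. -/

/-! ## §C Natural strengthenings (analysis) -/

/-! ### C1. Uniform `M` (∃ M before ∀ u) is FALSE on paper — not yet formal
Given ONE classical LH solution `(u,p)` on `[0,T₀)` from Schwartz data with nonzero planar flux `Φ₀` at `t = 0`
(needs the local existence theorem: Fujita–Kato + parabolic regularity + `IsClassicalNSSolutionOn.isLerayHopfOn`),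
the amplitude-rescaled data `A·u(0)` have flux `A·Φ₀` and classical lifespan `≳ A⁻²`; the parabolic rescaling
`u ↦ λu(λx, λ²t)` (flux-invariant: the flux has the dimension of a circulation, critical) restores any prescribed
`T`. So `sup` over solutions is `∞` for every `(ν,T)`. This is why the route filed the DATA-NORMALISED form
`FluxDataBound` (stmt-15602). A Lean proof is a negative lemma MODULO `H := local classical LH existence from
Schwartz div-free data` (candidate for a later cycle:
`uniformFlux_false_of_localExistence : H → ¬(∀ ν T, 0<ν → 0<T → ∃ M, ∀ u p, … → flux ≤ M)`); the scaling
covariance of `IsClassicalNSSolutionOn`/`IsLerayHopfOn`/`HasRapidSpatialDecay` is the bulk of the work. -/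

/-! ### C2. A POINTWISE-IN-TIME fold budget is false at `t = 0` for admissible data (infinite initial fold complexity)
The line's functional integrates the fold-creation rate `Σ⁺_ε(τ) = ∫_{ℝ³}(s_ε)⁺` against `(t−τ)^{-1/2}dτ`; as
`ε → 0⁺`, by the coarea formula `∫_{ℝ³} (ε²/F_ε(f)³) g |∇f| dx = ∫ ρ_ε(s) A_g(s) ds`, `ρ_ε(s) = ε²/(s²+ε²)^{3/2}`
(mass 2), `A_g(s) = ∫_{f=s} g dH²`, so `Σ⁺_0(τ) ≈ 2∫_{Z_τ} (−uₙ ω_∥·ν_Z)⁺ (|∇_∥f|/|∇f|) dH²` is a WEIGHTED AREA OF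
THE NODAL SET `Z_τ = {ω(τ)·n = 0} ⊂ ℝ³`. `HasRapidSpatialDecay` (Schwartz bounds) allows `Σ⁺_0(0) = +∞`: take an
axisymmetric no-swirl background `U` (vortex ring: `ω_z ≡ 0`, `U_z ≠ 0`, `ω_θ ≠ 0` in the core) plus, in disjoint
balls `Ω_k → x*` (core point) of volumes `V_k = 2^{-k}`, div-free checkerboard perturbations `a_k curl(ψ_k e)` with
`(curl ·)_z ≈ a_k sin(x₀/ℓ_k)sin(x₁/ℓ_k)sin(x₂/ℓ_k)`, `ℓ_k = 2^{-4k}`, `a_k = exp(−1/ℓ_k)` (smooth at `x*`): nodal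
area `≈ V_k/ℓ_k = 2^{3k}` per ball with `O(1)` weights `|U_z||ω_θ|` ⇒ `Σ⁺_0(0) = ∞`. So `sup_τ Σ⁺(τ) < ∞` is NOT an
a-priori fact even for `t ≈ 0`; any proof must use the time integration (the line does). -/

/-! ### C3. Monotonicity of `Φ*` (M = initial sup-flux) is false numerically
(card kit j004756: `Φ*` grows ×1.5–2.0 at Re ≈ 700–1400); no explicit rapidly decaying 3-D solution exists to
certify it in Lean. The 2-D and axisymmetric-no-swirl corners (`S ≡ 0`, `Φ*` non-increasing) are calibration
lemmas for the provers, not targets here. -/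

/-! ## §D Targets — line `registered` (`Lines/birth.lean` rev 2), stub by stub -/

/-! ### D1 `stub_decayPersistence` [known theorem on paper; keep]
Cubic weighted bounds of `Dᵏu`, `k ≤ 3`, on `[0,t] × ℝ³`, `t < T`: true along the strong solution (`T ≤ T*` by B1;
space decay of mild solutions `|x|⁻⁴` for `u`, `|x|^{-4-k}` for derivatives, Brandolese 2004 / Kukavica–Torres
2006), so `(1+|x|)³` is below the generic `|x|⁻⁴` ceiling (instantaneous spreading forbids `(1+|x|)^{4+δ}|u| ≤ C`
for generic data — the stub rightly asks only cubic). Mutation: drop LH ⇒ non-unique classical solutions without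
energy control are conceivable (Tychonoff-type), not constructible; drop decay ⇒ fails at `s = 0` but no classical
LH solution with slowly decaying smooth `L²` data is constructible here. No cheap cex. NOTE for D4: cubic decay
does not give `∇u ∈ L¹(ℝ³)`. -/

/-! ### D2 `stub_epsFoldLaw` [identity re-derived; keep]
By hand (frame `R = 1`, plane `{x₂ = c}`, `f = ω₂`, `w₂ = νΔf − v·∇f + ω·∇v₂`, using only `div v = 0`,
`div ω = 0` and decay for the in-plane integrations by parts): viscous `ν∫F'(f)Δf = ν∫∂₂²(F∘f) − ν∫F''|∇f|²`
(in-plane Laplacian integrates to 0); transport `−∫F'(f)v·∇f = −∫∂₂v₂ F(f) − ∫v₂F'(f)∂₂f`; stretching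
`∫F'(f)ω·∇v₂ = −∫v₂F''(f)ω_∥·∇_∥f + ∫v₂F'(f)∂₂f + ∫F'(f)f∂₂v₂` (`∇_∥·ω_∥ = −∂₂f`); sum:
`−∫v₂F''(f)(ω₀∂₀f+ω₁∂₁f) + ∫∂₂v₂(fF'(f) − F(f)) = … − ε²∫∂₂v₂/F(f)` — EXACTLY the four terms and signs of
`Theorems.SlicedKelvin.EpsFoldLawOn` (with `convect a b x = Db(x)[a x]`, so `w = νΔω − convect v ω + convect ω v`
✓, and the full 3-D `|∇f|²` in the annihilation term ✓). Frame covariance incl. REFLECTIONS: pulling back by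
`R ∈ O(3)`, `ṽ = R⁻¹∘v∘R` has `curl ṽ = (det R) R⁻¹(curl v)∘R`; `det R = ±1` enters every term an even number of
times (`F` even, `F'` odd, `w̃ = (det R)R⁻¹w∘R`), so the general-frame identity follows from the coordinate one —
no orientation hypothesis is missing. Cubic decay of `Dᵏv`, `k ≤ 3`, makes every plane integrand `O((1+|y|)⁻³)`
(integrable on `ℝ²`) and kills the IBP boundary terms ✓. Numerical confirmation over random Gaussian div-free
fields, 6 frames (2 reflections), 3 heights, 2 ε, 2 ν, plus wrong-variant sensitivity (transport/stretching
swapped; in-plane-only `|∇f|²`): kit job j024721 (table in `outputs/foldlaw_check.json`; verdict recorded in the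
crux item's evidence notes).
MUTATION of the stub's hypotheses: drop `IsDivFree v` ⇒ FALSE — `Negative.epsFoldLaw_false_without_divFree`
(`Theorems/PlanarFluxAPriori/Negative/EpsFoldLawFalseWithoutDivFree.lean`, p154029): for `v = ∇(½x₂²ψ)`, `R = 1`,
plane `{x₂ = 0}`, `ε = 1`, the identity collapses to `0 = −∫_{ℝ²}ψ(y,0)dy`; so incompressibility enters
GENUINELY (through the in-plane IBP of transport, `∫v_∥·∇_∥F(f) = +∫∂ₙvₙF(f)`, whose trace is the ε-term), not
only via `div ω = 0`. `0 < ε` can be weakened to `ε ≠ 0` (`F_ε` is even in `ε`); `ContDiff`/decay only keep the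
Bochner integrals honest (dropping them gives junk, not information). -/

/-- **D2b (`0 < ε` is only `ε ≠ 0`).** The ε-fold law is even in `ε` (only `ε²` occurs), so the stub's `0 < ε`
may be weakened to `ε ≠ 0`; at `ε = 0` the statement changes meaning (`F₀ = |·|`, junk derivatives of `|f|` at
the nodal set), which is why SOME non-degeneracy of `ε` must stay. [folklore] -/
theorem epsFoldLawOn_neg_iff (ν ε c : ℝ) (R : EuclideanSpace ℝ (Fin 3) ≃ₗᵢ[ℝ] EuclideanSpace ℝ (Fin 3))
    (v : EuclideanSpace ℝ (Fin 3) → EuclideanSpace ℝ (Fin 3)) :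
    Theorems.SlicedKelvin.EpsFoldLawOn ν (-ε) c R v ↔ Theorems.SlicedKelvin.EpsFoldLawOn ν ε c R v := by
  simp only [Theorems.SlicedKelvin.EpsFoldLawOn, neg_sq]

/-- The zero field has zero vorticity (for the non-vacuity checks below). [folklore] -/
theorem curl_zero_field (x : EuclideanSpace ℝ (Fin 3)) :
    curl (fun _ : EuclideanSpace ℝ (Fin 3) => (0 : EuclideanSpace ℝ (Fin 3))) x = 0 := by
  ext i
  fin_cases i <;> simp [curl]

/-- The ε-fold density of the zero field vanishes identically. [folklore] -/
theorem foldDensity_zero (R : EuclideanSpace ℝ (Fin 3) ≃ₗᵢ[ℝ] EuclideanSpace ℝ (Fin 3)) (ε : ℝ)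
    (x : EuclideanSpace ℝ (Fin 3)) :
    Theorems.SlicedKelvin.foldDensity (fun _ => 0) R ε x = 0 := by
  simp [Theorems.SlicedKelvin.foldDensity]

/-- **D3a (non-vacuity of the package: `FoldLawSubsolution` holds at rest).** The conclusion of
`stub_foldLawPackage` is satisfiable — the rest state `u ≡ 0` satisfies `FoldLawSubsolution ν T 0` with
`φ = S = 0`, `B = 0` (so the 15-clause definition is not contradictory by a typo; in particular the sign
conventions `F_ε(f) − ε ≥ 0`, `max s 0` and the inequality `φₜ − νφ₂ ≤ S` are consistent). [folklore] -/
theorem foldLawSubsolution_rest (ν T : ℝ) :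
    Theorems.SlicedKelvin.FoldLawSubsolution ν T (fun _ _ => 0) := by
  intro t ht ε hε R
  have hsq : Real.sqrt (ε ^ 2) = ε := Real.sqrt_sq hε.1.le
  have hφ : ∀ τ c, Theorems.SlicedKelvin.fluxProfile (fun _ _ => 0) R ε τ c = 0 := by
    intro τ c
    simp [Theorems.SlicedKelvin.fluxProfile, hsq]
  have hS : ∀ τ c, Theorems.SlicedKelvin.foldSource (fun _ _ => 0) R ε τ c = 0 := by
    intro τ c
    simp [Theorems.SlicedKelvin.foldSource, foldDensity_zero]
  refine ⟨fun _ _ => 0, fun _ _ => 0, fun _ _ => 0, fun _ _ => 0, fun _ _ => 0, 0,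
    fun τ c => (hφ τ c).symm, fun τ c => (hS τ c).symm, continuousOn_const, continuousOn_const,
    continuousOn_const, fun τ _ c => hasDerivAt_const _ _, fun τ _ c => hasDerivAt_const _ _,
    fun τ _ c => hasDerivAt_const _ _, fun τ _ c => by simp, fun τ _ c => by simp,
    fun τ _ c => by simp, fun τ _ c => by simp, fun τ _ c => by simp, fun c => ?_⟩
  have : (fun y : EuclideanSpace ℝ (Fin 2) => Real.sqrt (inner ℝ (curl ((fun _ _ => (0 :
      EuclideanSpace ℝ (Fin 3))) t) (R (WithLp.toLp 2 ![y 0, y 1, c]))) (R (EuclideanSpace.single 2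
      1)) ^ 2 + ε ^ 2) - ε) = fun _ => 0 := by
    funext y
    simp [hsq]
  rw [this]
  exact integrable_zero _ _ _

/-- **D3b (non-vacuity of the identity: `EpsFoldLawOn` holds at rest).** All integrands vanish for `v ≡ 0`. [folklore] -/
theorem epsFoldLawOn_rest (ν ε c : ℝ) (R : EuclideanSpace ℝ (Fin 3) ≃ₗᵢ[ℝ] EuclideanSpace ℝ (Fin 3)) :
    Theorems.SlicedKelvin.EpsFoldLawOn ν ε c R (fun _ => 0) := by
  simp [Theorems.SlicedKelvin.EpsFoldLawOn, convect]

/-! ### D3c `stub_foldLawPackage` [plausible; keep]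
Every clause of `FoldLawSubsolution` follows for fixed `ε ∈ (0,1)` from the identity + vorticity equation + cubic
decay of `Dᵏu (k ≤ 3)` uniformly on `[0,t]`: `φ_ε, ∂_cφ_ε, ∂_c²φ_ε` need `D^{≤3}u`
(`∂_c²F(f) = F''(∂_cf)² + F'∂_c²f`, `|F''| ≤ 1/ε`); `∂_τφ_ε = ∫F'(f)∂_τf` with
`∂_τ f = n·(νΔω − (u·∇)ω + (ω·∇)u)` (the pressure drops out under `curl`; commuting `∂_t` with `curl` uses the joint
`C^∞` of the classical solution, one-sided at `τ = 0`) — again `D^{≤3}u` and products, all `O((1+|y|)⁻³)` on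
planes, uniformly in `c` and `τ ∈ [0,t]`; the subsolution inequality drops `−ν∫F''|∇f|² ≤ 0` and bounds
`∫s_ε ≤ ∫(s_ε)⁺`. No soft hypothesis found. (The `B`-bounds are per `ε`; fine, `∃ B` comes after `ε`.) -/

/-! ### D4 `stub_foldCreationBudget` [XL; the crux in Duhamel clothing — what the attacks say]
(i) FALSE without the energy class, through the ε-term (A5, p152654).
(ii) The ε-term `−ε²∂ₙuₙ/F_ε(f)` contributes `≤ ε‖(∂ₙuₙ)⁻(τ)‖_{L¹(ℝ³)}` to `Σ⁺_ε(τ)`; it vanishes in the `liminf`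
only if `∫₀ᵗ(t−τ)^{-1/2}‖∇u(τ)‖_{L¹(ℝ³)}dτ < ∞` — true for NS flows from Schwartz data (`|∇u| ≲ |x|⁻⁵`), NOT under the
cubic decay of the package; where `f ≡ 0` on an open set, `s_ε = −ε∂ₙuₙ` exactly (A5's mechanism).
(iii) `t → 0⁺` ATTACK (infinite initial fold complexity, C2) — and why it FAILS. With data as in C2,
`Σ⁺_0(τ) → ∞` as `τ → 0⁺`; the stub needs `∫₀ᵗ (ν(t−τ))^{-1/2} Σ⁺_0(τ)dτ` bounded (Fatou puts `liminf_ε` inside), and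
since `∫₀ᵗ(t−τ)^{-1/2}τ^{-1/2}dτ = π` the budget dies iff `Σ⁺_0(τ) ≥ τ^{-1/2}g(τ)` with `g → ∞`. Persistence of a
fine fold pattern of scale `ℓ` and vorticity amplitude `a` under NS: zeros of `ω·n` are NOT removed by diffusion
alone (a damped pure mode keeps its zeros); they disappear when a COARSE component of `ω·n` exceeds the damped
pattern `a e^{-3ντ/ℓ²}`. Coarse `ωₙ` is generated in the pattern region at a polynomial rate `J > 0` (pressure
tails of the `O(1)` structures' nonlinearity, `∝ a₁²`; linear spectral leakage `∝ a e^{-ρ/ℓ}` is harmless; an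
axisymmetric background contributes `0`), so the pattern survives for `τ ≲ min(ℓ²log(1/a)/3ν, a/J)`. Smoothness at
the accumulation point forces `a_k ≤ exp(−c/ℓ_k)` (super-polynomially faint), whence the survival time `a_k/J` is
super-polynomially short and `Σ⁺_0(τ) ≤ Σ_{k : a_k ≳ Jτ} V_k/ℓ_k = τ^{-o(1)}` — integrable: `D(u;R,t) → 0` as
`t → 0⁺`. Regions escaping to infinity fail for the dual reason (Schwartz weights `|uₙ||ω_∥|` decay
super-polynomially while all gains are polynomial). CONCLUSION: Schwartz decay self-consistently protects the
small-time end of the budget; the stub's genuine content is the approach `t ↑ T = T*`, i.e. the crux itself (B1),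
plus a positive-time finiteness statement (`Σ⁺_0(τ) < ∞` for `τ > 0` by space analyticity of NS flows —
Masuda 1967 / Grujić–Kukavica 1998 — and locally finite `H²`-measure of analytic nodal sets).
(iv) What a prover must therefore supply near `t = 0`: a NODAL-AREA bound for `ω(τ)·n` of the form
`∫₀ᵗ(t−τ)^{-1/2} H²_w(Z_τ) dτ < ∞` — not in print for NS (nodal-set bounds for parabolic equations: Han–Lin 1994,
Chen 1998, in terms of a frequency/doubling index that is not a-priori controlled here). This is an honest gap in
the line even for SHORT times, independent of blow-up. -/

/-! ## §E Near-misses: none carried with `sorry`. -/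

/-! ## §F Line `Sketch` (skeleton rev 4, lead c1) — `stub_slabApexBound` (cycle g2-1, 2026-08-17)

### F0 The target
`stub_slabApexBound : ∀ ν T > 0, ∀ u p, classical → LH → decay(u 0) → ∀ t₀ ∈ Ioo 0 T, ∃ M : ℝ≥0, ∃ h > 0, ∀ t ∈ Ico t₀ T,
∀ R c, liminf_{ε→0⁺} ∫⁻_{|⟪x,Re₂⟫−c|<h} ofReal((ε²/√(f²+ε²)³)·|Df[curl u(t)]|) ≤ M`, `f = ⟪curl u(t), Re₂⟫` — the Γ-weighted
ε-apex functional of slabs (Lines/Sketch.md §1: `= ∫|ω·∇(H_ε∘f)|`, the total variation of `H_ε(ω_n)` ALONG THE VORTEX LINES).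
Mutation of its hypotheses: LH + decay are spent upstream (Constantin, decay persistence) exactly as A1/A5 demand; the two
hypotheses specific to this stub are (i) that `u t` is an NS slice (not an arbitrary smooth decaying field) and (ii) `t₀ > 0`.
BOTH ARE LOAD-BEARING (F1, F2). -/

/-- **F1 (kinematic form FALSE; LANDED p163175 `Negative.slabApexBound_false_kinematic`).** The stub's conclusion for a
general field `v` under the hypotheses of the line's kinematic stubs (`ContDiff ℝ ⊤ v` + cubic decay of `Dᵏv`, `k ≤ 3`) fails:
no `Cᵏ`/Schwartz/decay information on a slice bounds the apex functional. (Also `Negative.slabApexBound_false_forData`: false for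
smooth, rapidly decaying, divergence-free fields = admissible Clay data.) [folklore] -/
theorem sketch_slabApexBound_false_kinematic :
    ¬ (∀ (v : EuclideanSpace ℝ (Fin 3) → EuclideanSpace ℝ (Fin 3)), ContDiff ℝ (⊤ : ℕ∞) v →
      (∃ C : ℝ, ∀ (x : EuclideanSpace ℝ (Fin 3)) (k : ℕ), k ≤ 3 → (1 + ‖x‖) ^ 3 * ‖iteratedFDeriv ℝ k v x‖ ≤ C) →
      ∃ M : NNReal, ∃ h : ℝ, 0 < h ∧ ∀ (R : EuclideanSpace ℝ (Fin 3) ≃ₗᵢ[ℝ] EuclideanSpace ℝ (Fin 3)) (c : ℝ),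
        Filter.liminf (fun ε : ℝ => ∫⁻ x in {x : EuclideanSpace ℝ (Fin 3) |
            |inner ℝ x (R (EuclideanSpace.single 2 1)) - c| < h},
          ENNReal.ofReal (ε ^ 2 / Real.sqrt (inner ℝ (curl v x) (R (EuclideanSpace.single 2 1)) ^ 2
            + ε ^ 2) ^ 3 *
            |fderiv ℝ (fun z => inner ℝ (curl v z) (R (EuclideanSpace.single 2 1))) x (curl v x)|))
          (nhdsWithin 0 (Set.Ioi 0)) ≤ (M : ENNReal)) :=
  Theorems.PlanarFluxAPriori.Negative.slabApexBound_false_kinematic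

/-- **F2 (`t₀ > 0` is load-bearing; LANDED p163175 `Negative.slabApexBound_false_from_initialTime`).** The registered stub
with `t₀ ∈ Set.Ico 0 T` in place of `Set.Ioo 0 T` (everything else verbatim) is FALSE: local classical Leray–Hopf existence
(`local_classical_lerayHopf_holds`, proved in tree) from the apex-foam datum, evaluated at `t = t₀ = 0`, `R = 1`, `c = 0`.
So the bound `M` must depend on `t₀` (plausibly `M(t₀) ↑ ∞` as `t₀ ↓ 0` along that solution — not proved: it needs the
total variation along the TRUE vortex lines of `ω(t)`, a flow-box Fubini). [folklore] -/
theorem sketch_slabApexBound_false_from_initialTime :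
    ¬ (∀ (ν T : ℝ), 0 < ν → 0 < T → ∀ (u : ℝ → EuclideanSpace ℝ (Fin 3) → EuclideanSpace ℝ (Fin 3))
      (p : ℝ → EuclideanSpace ℝ (Fin 3) → ℝ),
      IsClassicalNSSolutionOn (Set.Ico 0 T) ν 0 u p → IsLerayHopfOn T ν 0 (u 0) u →
      HasRapidSpatialDecay (u 0) →
      ∀ t₀ ∈ Set.Ico 0 T, ∃ M : NNReal, ∃ h : ℝ, 0 < h ∧ ∀ t ∈ Set.Ico t₀ T,
        ∀ (R : EuclideanSpace ℝ (Fin 3) ≃ₗᵢ[ℝ] EuclideanSpace ℝ (Fin 3)) (c : ℝ),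
        Filter.liminf (fun ε : ℝ => ∫⁻ x in {x : EuclideanSpace ℝ (Fin 3) |
            |inner ℝ x (R (EuclideanSpace.single 2 1)) - c| < h},
          ENNReal.ofReal (ε ^ 2 / Real.sqrt (inner ℝ (curl (u t) x) (R (EuclideanSpace.single 2 1)) ^ 2
            + ε ^ 2) ^ 3 *
            |fderiv ℝ (fun z => inner ℝ (curl (u t) z) (R (EuclideanSpace.single 2 1))) x (curl (u t) x)|))
          (nhdsWithin 0 (Set.Ioi 0)) ≤ (M : ENNReal)) :=
  Theorems.PlanarFluxAPriori.Negative.slabApexBound_false_from_initialTime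

/-! ### F3 The witness: APEX FOAM (`Negative.ApexFoam.*`, LANDED)
`g = g₊ − g₋` smooth, `support g₊ = ⋃ᵢ (z₂ᵢ, b₂ᵢ)`, `support g₋ = ⋃ᵢ (z₂ᵢ₊₁, b₂ᵢ₊₁)`, `zₖ = 1/(2k+3)`, `bₖ = 1/(2k+2)`
(Mathlib `IsOpen.exists_contDiff_support_eq` — the flat oscillating profile comes for free, no `e^{-1/x²}sin(1/x)`);
`v = curl (χ Ψ₀)`, `Ψ₀ = (−x₀x₂g(x₁), 0, x₁x₂)`, `χ` a bump `= 1` on `B(0,2)`: smooth, compactly supported, divergence free,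
rapidly decaying (`ApexFoam.contDiff_vfield`, `…hasCompactSupport_vfield`, `…isDivFree_vfield`, `…hasRapidSpatialDecay_vfield`).
On `B(0,2)`: `v = (x₂, −x₀g(x₁), x₀x₂g'(x₁))`, `curl v = (x₀x₂g''(x₁), 1 − x₂g'(x₁), −g(x₁))` (`…curl_vfield_eq`), so
`f = ⟪curl v, e₂⟫ = −g(x₁)`, `Df[curl v] = −g'(x₁)(1 − x₂g'(x₁))`: vortex lines run along `e₁` and fold at every gap of the
pattern, infinitely often towards `x₁ = 0`. `ApexFoam.liminf_apex_eq_top`: for EVERY `h > 0`,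
`liminf_{ε→0⁺} ∫_{|x₂|<h} (ε²/√(f²+ε²)³)|Df[curl v]| = ⊤` — on the box `x₁ ∈ [0,1]`, `x₀² + x₂² < h'²` the crossing component is
`≥ ½`, Fubini in the swapped frame (tree `lintegral_lintegral_foliation`) factors the cross-section area, and per fold the
1-D charge is `∫_{(zₖ,mₖ]} |(H_ε∘g)'|/2 ≥ |H_ε(g(mₖ))|/2 ≥ ¼` once `ε ≤ |g(mₖ)|` (FTC); `K` folds ⇒ `≥ K·vol(B_{h'})/4`.
So the `∃ h` of the stub buys nothing against a foam (folds accumulate at a point). LOCALISED FORM (part 4,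
`Negative/SlabApexBoundFalseKinematicLocal.lean`, LANDED p164241): `ApexFoam.liminf_apex_eq_top_of_subset` — the functional is
`⊤` already on ANY set `A ⊇ B(0,2) ∩ {|x₂| < h}`, so every localisation `∫_{S_h(c) ∩ B_ρ}` (`ρ ≥ 2`; any `ρ > 0` by scaling) —
in particular the kinematic / `t₀ = 0` forms of `stub_apexLocalBound` of the strategist's line `local-far` — is killed by the
same witness; the radius split moves no difficulty out of the local stub. -/

/-! ### F4 Why the stub itself resists, and what a proof must therefore contain
(a) As registered the stub quantifies over NS slices at `t ≥ t₀ > 0`; the only such slices constructible here are trivial.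
(b) CONTENT FORCED BY F1/F2: positivity of time must enter QUANTITATIVELY and through STRUCTURE of `ω(t)·n`, not size:
finiteness of the functional = finitely many (weighted) folds per compact set — real analyticity / unique continuation —
made UNIFORM in `t ∈ [t₀,T)`, `n ∈ S²`, `c ∈ ℝ`, and summable in the far field. I.e. a frequency / nodal-count bound for the
scalar `f = ω·n`, which solves `∂ₜf + u·∇f − νΔf = ((ω·∇)u)·n` (inhomogeneous!). In print (fresh search, this cycle):
Huang–Jiang arXiv:2406.05877 (2024, p.1): `H^{n−1}(Z_t) < ∞` for every time slice of a HOMOGENEOUS scalar parabolic equation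
with Lipschitz leading coefficients — qualitative, per slice, no source term ("the singular set `{u = |∇u| = 0}` may coincide
with the nodal set"); Lin 1991 (CPAM 44, analytic time-independent coefficients), Han–Lin 1994 (CPAM 47: codimension-one
estimate under a DOUBLING assumption, space-time nodal sets), Angenent (n = 1, zero number non-increasing); Kukavica's
Grashof-polynomial LENGTH bounds for vorticity nodal lines of 2-D periodic NS. Nothing uniform-in-time, nothing for a
component `ω·n` of 3-D NS, nothing in the far field: the stub's genuine content = a quantitative doubling/frequency bound for
`ω·n` up to `T` (⊇ the crux as `t ↑ T*`, B1) — open.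
(c) DEFECT OF THE FUNCTIONAL (information for the lead): the one-sided foam `g ≥ 0` (`support g = U`) is a witness too
(`liminf_apex_eq_top` needs only `g(zₖ) = 0 ≠ g(mₖ)`): there `f = −g ≤ 0` NEVER changes sign and the regular nodal set
`{f = 0, ∇f ≠ 0}` is EMPTY, yet the functional is `+∞` — `liminf_ε ∫H_ε'(f)|q|` is the total variation of `sign f` along the
vortex lines (`0 → −1 → 0` costs `2·Γ` per TOUCHING), not `2∫_{Z_reg}|ω·N| dH²`. The identification in Lines/Sketch.md §1
needs `0` to be a regular value of `f = ω·n`, which fails on a dense set of `(R, c, t)`; any proof must bound the TV form,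
i.e. also pay for near-touchings (Sard in `c` does not help: the slab integrates over heights).
(d) The hypotheses of the landed kinematic stubs are not all needed (information): `stub_apexLipschitz` uses only
`k ≤ 2` of the cubic decay and `ε ≠ 0` (at `ε = 0` its slab term vanishes and the inequality `Φ̃(c) ≤ Φ̃(c')` is false);
no `IsDivFree` anywhere in the line (A6 of line birth does not transfer: `div curl = 0` is all that is used). -/

/-! ### F5 Next attacks (if re-armed)
(i) the DYNAMIC statement `sup_{t∈(0,t₁)} apex(u(t)) = ∞` for the solution from the sign-alternating foam (stability of
transversal sign changes under `C¹`-small perturbation + TV along true vortex lines: needs flow-box coordinates for `ω(t)`);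
(ii) a far-field foam at positive time is NOT available (weights decay); (iii) if the lead reshapes the stub to the TV-of-sign /
regular-value form, re-run F1 (the alternating foam still kills the kinematic form: its zeros are flat but two-sided). -/


end Summit.NavierStokesRegularity.NavierStokesRegularity.Cruxes.PlanarFluxAPriori.Disproof

end
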